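import Summits.BirchSwinnertonDyer.BirchSwinnertonDyer.Theorems.ThetaPartnerAtTwoSignedKatoUpToAtTwoIwasawaInvolutionCompat
import Summits.BirchSwinnertonDyer.BirchSwinnertonDyer.Theorems.ThetaPartnerAtTwoSignedKatoUpToAtTwoLocalDualTranspose
import HarnessLib

/-!
# Route `ThetaPartnerAtTwo` (TP2), crux K3 `SignedKatoDivisibilityUpToAtTwo` (item stmt-BirchSwinnertonDyer-20308),
# line `colemanrat` v5 — THE TRANSPOSE INTO A PINNED DUAL `D : SignedSelmerDualData W κ γ ε` OF A LOCAL DUAL WHOSE `T` ACTS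
# THROUGH `conj_{γ⁻¹}` IS `ι`-SEMILINEAR FOR THE FULL `Λ`-ACTION — the (PT) map `j` of stub (R2^ι) in its registered shape
# `j : P →+ D.X`, `j (g • y) = IwasawaAlgebra.invol 2 g • j y`, with EXACT local cover (`m = 0`)

Width seat `bsd-wall-tp2-p2x-w3` g3 (cell `bsd-wall`). HONEST FRAMING: THEOREMS ONLY — no definition, no named fact, no instance,
no `sorry`; closes no item; BSD is NOT proved by any of this.

## Why this file

The predecessor's `…LocalDualTranspose` (w3 g2, p595110) proves: for a pinned dual `D` over `γ`, ANY `r : Sel^ε_∞ → S'` intertwining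
`conj_γ` with an endomorphism `ψ'` of `S'`, and ANY `Λ`-module `P` read through `dP : P → Hom(S', ℚ/ℤ)` on which `T` acts through
`ψ' − 1` (and constants through `ℤ_p → ℤ/p^k`), the transpose `j : P → D.X` (`D.toDual (j y) s = dP y (r s)`) is `Λ`-LINEAR for the
FULL action (peeling induction over the local nilpotence of `conj_γ − 1`). The convention audit (G4-CONVENTION-AUDIT.md) shows that
the HONEST local dual of the K3 chain — Sprung's points model `Hom(E(ℚ_{∞,𝔭}), ℤ_p)` with `T·z = z ∘ g⁻¹ − z` (the structure making
the Coleman map `Λ`-linear; lead g4's `Sprung2012/LocalIwasawaModule`, p598149) — has `T` acting through `ψ'' − 1` where `ψ''`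
intertwines `conj_{γ⁻¹}`, NOT `conj_γ`; hence `j` is `ι`-SEMILINEAR (registered that way in v5's (R2^ι)). This file proves the
semilinear twin of the predecessor's theorem IN ONE STROKE from the `γ ↦ γ⁻¹` twist (`…IwasawaInvolutionTwist`): transpose into
the twisted datum `D′` over `δ = γ⁻¹` (where the predecessor's theorem applies verbatim and gives a `Λ`-LINEAR `j′`), and pull back
along the `ι`-semilinear identification `e : D.X ≃+ D′.X`. So once a local dual `(P, dP, ψ'')` with `T` acting through `ψ'' − 1`,
`ψ''` intertwining `conj_δ`, `γδ = 1`, is supplied (e.g. the points model with its honest `Λ`-structure), the (PT) map of (R2^ι) with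
its full `ι`-semilinearity `j (g • y) = IwasawaAlgebra.invol p g • j y` and the EXACT local cover (`m = 0`) are kernel theorems —
no continuity argument is repeated.

## What is proved

* §1 (any number field `K`, prime `p`, `ℤ_p`-extension `κ`, `γδ = 1`, sign `ε`, abstract `ι` with `hι`):
  **`transposeHom_semilinear`** (`j (f • y) = ι f • j y` for ALL `f ∈ Λ`), **`exists_semilinearTranspose`**,
  `mem_range_semilinearTranspose_iff` (exact local cover when `dP` is onto), `semilinearTranspose_eq_zero_iff`.
* §2 `K = ℚ`, `p = 2`, `S' = H¹(ker κ ⊓ D_v, E[2^∞])`, `r = res`, v5 spelling (`IwasawaAlgebra.invol 2`):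
  **`exists_semilinearTranspose_package_two`** — for ANY pinned local dual at `v` whose `conj'` intertwines `conj_δ` (`γδ = 1`):
  `∃ j : P →+ D.X` with `∀ g y, j (g • y) = IwasawaAlgebra.invol 2 g • j y`, (value), and the (LocCover) clause of
  `stub_localRobustPackageTwoInv` VERBATIM with `m = 0` (`∃ y, j y = C 2 ^ 0 • x`).

References: [Kobayashi2003] Thm. 1.2 (the object), §6, (8.23); [GreenbergLNM1716] §1 (p. 60: `X^ι`; the `Λ`-action via `conj`);
[PerrinRiou1994] §1.3.
-/

set_option autoImplicit false
-- the Theorems namespace of this sub repeats the summit name by design (D-0017 nested layout)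
set_option linter.dupNamespace false

noncomputable section

open scoped Classical NumberField

namespace Summit.BirchSwinnertonDyer.BirchSwinnertonDyer.Theorems

namespace SignedKatoOffTwo.IwasawaInvolution

open PowerSeries NumberField IsDedekindDomain Field WeierstrassCurve
  Literature.NumberTheory.EllipticCurves Literature.NumberTheory.EllipticCurves.Kobayashi2003
  Literature.NumberTheory.EllipticCurves.GreenbergSelmer Literature.NumberTheory.GaloisRepresentations
  Literature.Barriers.BirchSwinnertonDyer ZpExtension

universe u

/-! ## §1 The semilinear transpose (abstract `ι`) -/

section Transpose

variable {K : Type u} [Field K] [NumberField K] (W : WeierstrassCurve K) (p : ℕ) [Fact p.Prime]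
  (κ : ZpExtension K p) {γ δ : absoluteGaloisGroup K} (ε : ℤˣ)
  (ι : IwasawaAlgebra p ≃+* IwasawaAlgebra p) (D : SignedSelmerDualData W κ γ ε)
  {S' : Type*} [AddCommGroup S'] (r : signedSelmerInfty W κ ε →+ S')
  {P : Type*} [AddCommGroup P] [Module (IwasawaAlgebra p) P] (dP : P →+ (S' →+ AddCircle (1 : ℚ)))
  (ψ' : S' →+ S')

/-- **The transpose into a `γ`-datum of a local dual on which `T` acts through `ψ' − 1`, `ψ'` intertwining `conj_δ` (`γδ = 1`), is
`ι`-SEMILINEAR for the full `Λ`-action**: `j (f • y) = ι f • j y` for every `f ∈ Λ`. Proof: transpose into the twisted datum `D′` over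
`δ` (`…LocalDualTranspose.transposeHom_smul`: `Λ`-linear) and pull back along the `ι`-semilinear `e : D.X ≃+ D′.X`
(`exists_twist_signedSelmerDualData`), using `ι ∘ ι = id`. [cite: Kobayashi2003, Thm. 1.2 (the object) and (8.23) (p. 18)]
[cite: GreenbergLNM1716, §1 p. 60] -/
theorem transposeHom_semilinear (hι : ∀ f : IwasawaAlgebra p, ι f = subst (invOnePlusSubOne : ℤ_[p]⟦X⟧) f)
    (hγδ : γ * δ = 1) (hr : ∀ s : signedSelmerInfty W κ ε, r (conjSignedSelmerInfty W κ ε δ s) = ψ' (r s))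
    (hT : ∀ (y : P) (t : S'), dP ((PowerSeries.X : IwasawaAlgebra p) • y) t = dP y (ψ' t) - dP y t)
    (hC : ∀ (c : ℤ_[p]) (y : P) (t : S') (k : ℕ), p ^ k • t = 0 →
      dP ((PowerSeries.C c : IwasawaAlgebra p) • y) t = (PadicInt.toZModPow k c).val • dP y t)
    (j : P →+ D.X) (hj : ∀ (y : P) (s : signedSelmerInfty W κ ε), D.toDual (j y) s = dP y (r s))
    (f : IwasawaAlgebra p) (y : P) : j (f • y) = ι f • j y := by
  obtain ⟨D', e, he, hdual⟩ := exists_twist_signedSelmerDualData ι hι hγδ D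
  set j' : P →+ D'.X := e.toAddMonoidHom.comp j with hj'def
  have hj' : ∀ (y : P) (s : signedSelmerInfty W κ ε), D'.toDual (j' y) s = dP y (r s) := fun y s ↦ by
    rw [hj'def, AddMonoidHom.comp_apply, AddEquiv.coe_toAddMonoidHom, hdual, hj]
  have hlin : j' (f • y) = f • j' y := LocalChar.transposeHom_smul W p κ ε D' r dP ψ' hr hT hC j' hj' f y
  apply e.injective
  have h2 : e (ι f • j y) = ι (ι f) • e (j y) := he (ι f) (j y)
  rw [invol_invol ι hι] at h2
  rw [h2]
  simpa [hj'def] using hlin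

/-- **The `ι`-semilinear transpose exists** (value formula + full semilinearity). [cite: Kobayashi2003, Thm. 1.2 (the object) and (8.23) (p. 18)] -/
theorem exists_semilinearTranspose (hι : ∀ f : IwasawaAlgebra p, ι f = subst (invOnePlusSubOne : ℤ_[p]⟦X⟧) f)
    (hγδ : γ * δ = 1) (hr : ∀ s : signedSelmerInfty W κ ε, r (conjSignedSelmerInfty W κ ε δ s) = ψ' (r s))
    (hT : ∀ (y : P) (t : S'), dP ((PowerSeries.X : IwasawaAlgebra p) • y) t = dP y (ψ' t) - dP y t)
    (hC : ∀ (c : ℤ_[p]) (y : P) (t : S') (k : ℕ), p ^ k • t = 0 →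
      dP ((PowerSeries.C c : IwasawaAlgebra p) • y) t = (PadicInt.toZModPow k c).val • dP y t) :
    ∃ j : P →+ D.X, (∀ (y : P) (s : signedSelmerInfty W κ ε), D.toDual (j y) s = dP y (r s)) ∧
      ∀ (f : IwasawaAlgebra p) (y : P), j (f • y) = ι f • j y := by
  obtain ⟨j, hj⟩ := LocalChar.exists_transposeHom W p κ ε D r dP
  exact ⟨j, hj, transposeHom_semilinear W p κ ε ι D r dP ψ' hι hγδ hr hT hC j hj⟩

omit [Module (IwasawaAlgebra p) P] in
/-- **Exact local cover for the (semilinear) transpose** (`dP` onto): `x ∈ im j ↔ D.toDual x` kills `ker r` — additivity only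
(`ℚ/ℤ` divisible: `LocalChar.exists_character_comp_eq_of_ker_le`). [cite: Kobayashi2003, (8.23) (p. 18)] -/
theorem mem_range_semilinearTranspose_iff (hdP : Function.Surjective dP) (j : P →+ D.X)
    (hj : ∀ (y : P) (s : signedSelmerInfty W κ ε), D.toDual (j y) s = dP y (r s)) (x : D.X) :
    x ∈ Set.range j ↔ ∀ s : signedSelmerInfty W κ ε, r s = 0 → D.toDual x s = 0 := by
  constructor
  · rintro ⟨y, rfl⟩ s hs
    rw [hj, hs, map_zero]
  · intro hx
    obtain ⟨χ', hχ'⟩ := LocalChar.exists_character_comp_eq_of_ker_le r (D.toDual x) hx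
    obtain ⟨y, rfl⟩ := hdP χ'
    refine ⟨y, D.bijective.injective (AddMonoidHom.ext fun s ↦ ?_)⟩
    rw [hj, ← hχ', AddMonoidHom.comp_apply]

omit [Module (IwasawaAlgebra p) P] in
/-- **Kernel of the transpose**: `j y = 0 ↔ dP y` kills `r(Sel^ε_∞)`. [cite: Kobayashi2003, Thm. 1.2 (proof) and (8.23)] -/
theorem semilinearTranspose_eq_zero_iff (j : P →+ D.X)
    (hj : ∀ (y : P) (s : signedSelmerInfty W κ ε), D.toDual (j y) s = dP y (r s)) (y : P) :
    j y = 0 ↔ ∀ s : signedSelmerInfty W κ ε, dP y (r s) = 0 := by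
  constructor
  · intro h s
    rw [← hj, h, map_zero, AddMonoidHom.zero_apply]
  · intro h
    refine D.bijective.injective (AddMonoidHom.ext fun s ↦ ?_)
    rw [hj, h s, map_zero, AddMonoidHom.zero_apply]

end Transpose

/-! ## §2 `K = ℚ`, `p = 2`: the (PT) map of (R2^ι) in v5 spelling, for ANY pinned local dual over `γ⁻¹` -/

section Two

variable (W : WeierstrassCurve ℚ) (κ : ZpExtension ℚ 2) {γ δ : absoluteGaloisGroup ℚ} (ε : ℤˣ)

/-- **The (PT) map `j` of stub (R2^ι) for ANY pinned local dual at `v` on which `T` acts through a `conj'` intertwining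
`conj_δ`, `γδ = 1`** (the honest points model is of this kind): `j : P →+ D.X` ADDITIVE with
`∀ g y, j (g • y) = IwasawaAlgebra.invol 2 g • j y`, the value formula, and the (LocCover) clause of `stub_localRobustPackageTwoInv`
VERBATIM with `m = 0`. The semilinear twin of `LocalChar.exists_linearTranspose_package_two`.
[cite: Kobayashi2003, Thm. 1.2 (the object), §6 and (8.23)] [cite: GreenbergLNM1716, §1–2] -/
theorem exists_semilinearTranspose_package_two (hγδ : γ * δ = 1) (v : HeightOneSpectrum (𝓞 ℚ))
    (D : SignedSelmerDualData W κ γ ε)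
    (conj' : W.subgroupH1 2 (κ.kerSubgroup ⊓ decomp v) →+ W.subgroupH1 2 (κ.kerSubgroup ⊓ decomp v))
    (hconj : ∀ s : signedSelmerInfty W κ ε,
      resOfLe (W.geomPrimaryTorsion 2) (inf_le_left : κ.kerSubgroup ⊓ decomp v ≤ κ.kerSubgroup)
          (W.conjH1 2 κ.kerSubgroup δ (s : W.subgroupH1 2 κ.kerSubgroup)) =
        conj' (resOfLe (W.geomPrimaryTorsion 2) (inf_le_left : κ.kerSubgroup ⊓ decomp v ≤ κ.kerSubgroup)
          (s : W.subgroupH1 2 κ.kerSubgroup)))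
    {P : Type*} [AddCommGroup P] [Module (IwasawaAlgebra 2) P]
    (dP : P →+ (W.subgroupH1 2 (κ.kerSubgroup ⊓ decomp v) →+ AddCircle (1 : ℚ))) (hdP : Function.Surjective dP)
    (hT : ∀ (y : P) (t : W.subgroupH1 2 (κ.kerSubgroup ⊓ decomp v)),
      dP ((PowerSeries.X : IwasawaAlgebra 2) • y) t = dP y (conj' t) - dP y t)
    (hC : ∀ (c : ℤ_[2]) (y : P) (t : W.subgroupH1 2 (κ.kerSubgroup ⊓ decomp v)) (k : ℕ), 2 ^ k • t = 0 →
      dP ((PowerSeries.C c : IwasawaAlgebra 2) • y) t = (PadicInt.toZModPow k c).val • dP y t) :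
    ∃ j : P →+ D.X,
      (∀ (g : IwasawaAlgebra 2) (y : P), j (g • y) = IwasawaAlgebra.invol 2 g • j y) ∧
      (∀ (y : P) (s : W.subgroupH1 2 κ.kerSubgroup) (hs : s ∈ signedSelmerInfty W κ ε),
        D.toDual (j y) ⟨s, hs⟩ =
          dP y (resOfLe (W.geomPrimaryTorsion 2) (inf_le_left : κ.kerSubgroup ⊓ decomp v ≤ κ.kerSubgroup) s)) ∧
      (∀ x : D.X,
        (∀ t : signedSelmerInfty W κ ε,
          resOfLe (W.geomPrimaryTorsion 2) (inf_le_left : κ.kerSubgroup ⊓ decomp v ≤ κ.kerSubgroup)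
            (t : W.subgroupH1 2 κ.kerSubgroup) = 0 → D.toDual x t = 0) →
        ∃ y : P, j y = (PowerSeries.C (2 : ℤ_[2]) : IwasawaAlgebra 2) ^ 0 • x) := by
  set r : signedSelmerInfty W κ ε →+ W.subgroupH1 2 (κ.kerSubgroup ⊓ decomp v) :=
    (resOfLe (W.geomPrimaryTorsion 2) (inf_le_left : κ.kerSubgroup ⊓ decomp v ≤ κ.kerSubgroup)).comp
      (signedSelmerInfty W κ ε).subtype with hr_def
  have hr : ∀ s : signedSelmerInfty W κ ε, r (conjSignedSelmerInfty W κ ε δ s) = conj' (r s) := fun s ↦ by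
    rw [hr_def, AddMonoidHom.comp_apply, AddMonoidHom.comp_apply]
    show resOfLe _ _ ((conjSignedSelmerInfty W κ ε δ s : signedSelmerInfty W κ ε) : W.subgroupH1 2 κ.kerSubgroup) =
      conj' (resOfLe _ _ (s : W.subgroupH1 2 κ.kerSubgroup))
    rw [coe_conjSignedSelmerInfty_apply, hconj]
  obtain ⟨j, hj, hsl⟩ := exists_semilinearTranspose W 2 κ ε
    (IwasawaAlgebra.involEquiv 2 : IwasawaAlgebra 2 ≃+* IwasawaAlgebra 2) D r dP conj' (involEquiv_eq_subst 2) hγδ hr hT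
    (fun c y t k hk ↦ hC c y t k (by exact_mod_cast hk))
  refine ⟨j, fun g y ↦ hsl g y, fun y s hs ↦ hj y ⟨s, hs⟩, fun x hx ↦ ?_⟩
  rw [pow_zero, one_smul]
  exact (mem_range_semilinearTranspose_iff W 2 κ ε D r dP hdP j hj x).2 hx

end Two

end SignedKatoOffTwo.IwasawaInvolution

end Summit.BirchSwinnertonDyer.BirchSwinnertonDyer.Theorems

end
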